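import Literature.Probability.LatticeModels.InterfaceSLEFrontier
import Literature.Probability.RandomPlanarGeometry.SpinObservableShortTime
import HarnessLib

/-!
# Critical Ising interfaces and SLE₃: F2 from the observable's cylinder identity

Topic `Literature/Probability/LatticeModels` (family `crit-ising`). Seventh file of the
decomposition of **crit-ising.S17, spin half** — Chelkak–Duminil-Copin–Hongler–Kemppainen–
Smirnov, *Convergence of Ising interfaces to Schramm's SLE curves*, C. R. Math. Acad. Sci.
Paris 352 (2014) 157–161 (arXiv:1312.0533), Theorem 1; corrected transcription
`convergesInLawToSLE_three_isingInterface_zd` (`InterfaceSLEProofs.lean`), identification half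
F2 = `isSLELaw_three_of_subseqLimit_spinInterface` (CDHKS §3: every subsequential weak limit of
the critical spin-Ising interface laws is the chordal SLE₃ law).

Here F2 is reduced — by theorems only, no named fact is introduced — to the statement that the
printed proof of CDHKS §3 establishes before its last paragraph, in the monotone-class form in
which it is inherited from the lattice (the spin analogue of the FK half's layer-5 fact
`exists_cylinderObservableIdentity_fkInterface`, `FKIsingNaturalMartingale.lean`): for every
subsequential limit `ν` there are a chordal uniformizing map `φ` and a *regular version* `W` of
the driving process on the curve space — strongly measurable coordinates, continuous paths,
`W_0 = 0`, running supremum in `L³` on every `[0, t]` (CDHKS Thm. 3 = Kemppainen–Smirnov 2017,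
Thm. 1.5 with Cor. 1.7: "the driving process `W_t` … is Hölder continuous",
"`sup_δ E[exp(ε|W^δ_t|/√t)] < ∞`"), `ν`-a.e. Loewner-describing the limit curve
(`IsLoewnerDescribed`) — such that for every `y > 0` the time-limited spin observable
`N^y = Loewner.spinObservableProcess W y` of `RandomPlanarGeometry/SpinObservableShortTime.lean`
(the continuous branch of `((iy)² g_t'(iy)/(g_t(iy) - W_t)²)^{1/2}`, `t ≤ y²/9`, i.e. `iy · M_t`
for CDHKS's `M_t(z) = (∂_z[-G_t(w(z))⁻¹])^{1/2}` read at `w = iy`) satisfies the **cylinder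
identity**

  `∫ (N^y_t(c) - N^y_s(c)) ψ(W c (S 0), …, W c (S (n-1))) dν(c) = 0`

for all `s ≤ t`, all finite families of times `S ≤ s` and all continuous `|ψ| ≤ 1` — CDHKS §3:
"for any `z ∈ Ω`, the process `M_t(z)`, `t ≤ T(z)`, … is a martingale with respect to the
filtration `(𝓕_t)_{t ≥ 0}` generated by `W_t`". PROVED here:

* `isSLELaw_three_of_subseqLimit_spinInterface_of_cylinderIdentity` — F2 from that statement,
  along CDHKS's printed line: the tree's `Loewner.martingale_driver_of_spinCylinderIdentity`
  (cylinder identity ⟹ natural martingales by the monotone-class theorem ⟹ stopped spin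
  observable martingales by optional stopping at CDHKS's `τ(z)` ⟹ **`W_t` and `W_t² - 3t` are
  martingales** in the natural filtration of `W`, by the far-field expansion (5), exchanging
  expansion and conditional expectation thanks to the `L³` bound), then `W/√3` is a continuous
  local martingale with `⟨W/√3⟩_t = t`
  (`isLocalMartingale_and_hasQuadraticVariation_of_martingales`) and the unconditional criterion
  `isSLELaw_of_isLocalMartingale_driving_of_lt_four` (Lévy's characterisation, the SLE₃ trace
  and its transience are theorems of the tree) identifies `ν`;
* `convergesInLawToSLE_three_isingInterface_zd_of_traversalBound_of_cylinderIdentity` — hence the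
  corrected CDHKS Theorem 1 from the traversal bound (C1) `spinInterface_traversalBound` and the
  cylinder-identity statement.

**Review note (D-0026, 2026-08-15).** An earlier version of this file routed both results
through the named fact (M) `exists_drivingMartingales_of_subseqLimit_spinInterface` ("every
subsequential limit carries a driving process `W` with `W_t`, `W_t² - 3t` martingales",
CDHKS Thm. 3 and §3), proving (M) from the cylinder identity. The review found that fact to be
a decomposition slice of F2 — F2 minus the last sentence of its printed proof (Lévy's theorem),
carrying the same unvendored inputs (Kemppainen–Smirnov 2017, Thm. 1.5; Chelkak–Smirnov 2012,
Thms 1.2, 5.6) — and merges it back into F2's proof obligation: this file no longer routes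
through it, the two martingales appearing only as an intermediate step inside the proof below.

What the cylinder-identity statement still packages are exactly the two lattice inputs of the
printed proof and nothing else: (J) the convergence in law of the capacity driving processes of
the discrete interfaces to `W` along the subsequence, with the regularity of the limit
(Kemppainen–Smirnov 2017, Thm. 1.5, Cor. 1.7, from CDHKS Thm. 4/Rem. 4 = (C1)); (D) the discrete
fermionic observable martingale of the slit domains and its convergence "uniformly over all
possible domains" (Chelkak–Smirnov 2012, Thms 1.2, 5.6; CDHKS §3). The analytic passage from
(J) + (D) to the cylinder identity is the tree's PROVED
`Loewner.integral_cylinder_eq_zero_of_discreteMartingales` (`ObservableDiscretePassage.lean`),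
specialised to `N^y` in `RandomPlanarGeometry/SpinObservableLimitPassage.lean`; the moment
clause is removed altogether in `InterfaceSLELocal.lean` (localisation instead of CDHKS's
exchange of expansion and conditional expectation).

## References

* D. Chelkak, H. Duminil-Copin, C. Hongler, A. Kemppainen, S. Smirnov, *Convergence of Ising
  interfaces to Schramm's SLE curves*, C. R. Math. Acad. Sci. Paris 352 (2014) 157–161
  (arXiv:1312.0533): Thm. 1, Thm. 3, §3 (p. 7: "both coefficients `W_t` and `W_t² - 3t` are
  martingales. As `W_t` is almost surely continuous, Lévy's theorem implies that
  `W_t = √3 B_t`").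
* A. Kemppainen, S. Smirnov, *Random curves, scaling limits and Loewner evolutions*, Ann. Probab.
  45 (2017) 698–779, Thm. 1.5, Cor. 1.7, Prop. 3.8.
* D. Chelkak, S. Smirnov, *Universality in the 2D Ising model and conformal invariance of
  fermionic observables*, Invent. Math. 189 (2012) 515–580, Thms 1.2, 5.6.
-/

noncomputable section

open MeasureTheory Filter Topology
open UpperHalfPlane (upperHalfPlaneSet)
open scoped NNReal BoundedContinuousFunction
open Literature.Probability.LatticeModels Literature.Probability.Percolation
open Literature.Probability.RandomPlanarGeometry (CurveClass DobrushinDomain ConformalEquiv)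
open Literature.Probability.RandomPlanarGeometry.Loewner (spinObservableProcess)

namespace Literature.Probability.LatticeModels

/-! ### F2 and the corrected CDHKS Theorem 1 from the cylinder identity -/

/-- **F2 from CDHKS's observable martingale in cylinder form.** Suppose that for every
Dobrushin domain `(D; a, b)`, admissible discretisations `E`, interface-selection rules `sel`,
meshes `u n → 0⁺` and every probability measure `ν` on the curve space to which the critical
spin-Ising interface laws `spinInterfaceLaw D E sel (u n)` converge weakly, there are a chordal
uniformizing map `φ : ℍ → D` and a process `W : CurveClass ℂ → ([0, ∞) → ℝ)` with strongly
measurable coordinates, continuous paths, `W_0 = 0`, running supremum on each `[0, t]` a.s.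
dominated by a nonnegative `M ∈ L³(ν)` (CDHKS Thm. 3 = Kemppainen–Smirnov 2017, Thm. 1.5,
Cor. 1.7: Hölder driving process with finite exponential moments), `ν`-a.e. Loewner-describing
the curve through `φ` (`IsLoewnerDescribed`), and such that for every `y > 0` the time-limited
spin observable `N^y = Loewner.spinObservableProcess W y` satisfies the cylinder identity
`∫ (N^y_t - N^y_s) ψ(W_{S_0}, …, W_{S_{n-1}}) dν = 0` for all `s ≤ t`, `S ≤ s`, continuous
`|ψ| ≤ 1` (CDHKS §3: "`M_t(z)`, `t ≤ T(z)`, … is a martingale with respect to the filtration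
generated by `W_t`", in monotone-class form). Then every subsequential weak limit of the
critical spin-Ising interface laws is the chordal SLE₃ law of `(D; a, b)`
(`isSLELaw_three_of_subseqLimit_spinInterface`). Proof, along the printed line of CDHKS §3:
`W_t` and `W_t² - 3t` are martingales in the natural filtration of `W`
(`Loewner.martingale_driver_of_spinCylinderIdentity`: optional stopping at `τ(z)`, expansion
(5), exchange of expansion and conditional expectation by the `L³` bound), so `W/√3` is a
continuous local martingale with quadratic variation `t`
(`isLocalMartingale_and_hasQuadraticVariation_of_martingales`), and
`isSLELaw_of_isLocalMartingale_driving_of_lt_four` ("Lévy's theorem implies that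
`W_t = √3 B_t`"; the SLE₃ trace and its transience being theorems of the tree) identifies `ν`.
PROVED. [cite: CDHKSCRAS2014, Thm. 3 and §3 (proof of Thm. 1)] -/
theorem isSLELaw_three_of_subseqLimit_spinInterface_of_cylinderIdentity
    (h : ∀ (D : DobrushinDomain) (E : ℝ → DiscreteDobrushin) (_hE : IsDiscretisation D E)
      (sel : ℝ → SpinConfig (Site 2) → List (Sym2 (Site 2)))
      (_hsel : ∀ δ, IsInterfaceSelection (E δ) (sel δ))
      (u : ℕ → ℝ) (_hu : Tendsto u atTop (𝓝[>] 0))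
      (ν : Measure (CurveClass ℂ)) [IsProbabilityMeasure ν],
      (∀ f : CurveClass ℂ →ᵇ ℝ,
        Tendsto (fun n => ∫ c, f c ∂spinInterfaceLaw D E sel (u n)) atTop (𝓝 (∫ c, f c ∂ν))) →
      ∃ (φ : ConformalEquiv upperHalfPlaneSet D.carrier) (W : CurveClass ℂ → ℝ≥0 → ℝ),
        D.IsChordalUniformizing φ ∧
        (∀ t, StronglyMeasurable (fun c ↦ W c t)) ∧ (∀ c, Continuous (W c)) ∧ (∀ c, W c 0 = 0) ∧
        (∀ t : ℝ≥0, ∃ M : CurveClass ℂ → ℝ, MemLp M 3 ν ∧ (∀ c, 0 ≤ M c) ∧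
          ∀ᵐ c ∂ν, ∀ r, r ≤ t → |W c r| ≤ M c) ∧
        (∀ᵐ c ∂ν, RandomPlanarGeometry.IsLoewnerDescribed φ c (W c)) ∧
        ∀ y : ℝ, 0 < y → ∀ s t : ℝ≥0, s ≤ t → ∀ (n : ℕ) (S : Fin n → ℝ≥0), (∀ k, S k ≤ s) →
          ∀ ψ : (Fin n → ℝ) → ℝ, Continuous ψ → (∀ v, |ψ v| ≤ 1) →
            ∫ c, (spinObservableProcess (fun t c ↦ W c t) y t c -
                spinObservableProcess (fun t c ↦ W c t) y s c) *
              (ψ (fun k ↦ W c (S k)) : ℂ) ∂ν = 0) :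
    isSLELaw_three_of_subseqLimit_spinInterface := by
  intro D E hE sel hsel u hu ν hν hlim
  obtain ⟨φ, W, hφ, hW, hWc, hW0, hmom, hdesc, hcyl⟩ := h D E hE sel hsel u hu ν hlim
  -- CDHKS §3: "both coefficients `W_t` and `W_t² - 3t` are martingales"
  obtain ⟨hM₁, hM₂⟩ :=
    RandomPlanarGeometry.Loewner.martingale_driver_of_spinCylinderIdentity
      (W := fun t c ↦ W c t) (P := ν) hW hWc hW0 hmom hcyl
  -- "As `W_t` is almost surely continuous, Lévy's theorem implies that `W_t = √3 B_t`"
  obtain ⟨hloc, hQ⟩ := isLocalMartingale_and_hasQuadraticVariation_of_martingales hM₁ hM₂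
  have hsq : Real.sqrt ((3 : ℝ≥0) : ℝ) = Real.sqrt 3 := by norm_num
  refine RandomPlanarGeometry.isSLELaw_of_isLocalMartingale_driving_of_lt_four zero_lt_three
    (by norm_num) hφ (fun t ↦ (hW t).measurable) (ae_of_all _ hW0) (ae_of_all _ hWc)
    (𝓕 := Filtration.natural (fun t c ↦ W c t) hW) ?_ ?_ ?_
  · simpa only [hsq] using hloc
  · simpa only [hsq] using hQ
  · filter_upwards [hdesc] with c hc
    obtain ⟨-, γ, hγ, c', hc', hI⟩ := hc
    exact ⟨γ, hγ, c', hc', hI⟩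

/-- **CDHKS Theorem 1 (corrected transcription) from (C1) and the cylinder identity.**
Convergence in law of the critical spin-Ising Dobrushin interfaces to chordal SLE₃,
`convergesInLawToSLE_three_isingInterface_zd`, follows from the traversal bound (C1)
`spinInterface_traversalBound` (CDHKS §2) and the cylinder-identity statement above (CDHKS Thm. 3
and §3 before its last paragraph), everything else — tightness, Prokhorov, uniqueness in law
of chordal SLE, Lévy, the Rohde–Schramm theorems at `κ = 3`, and the passage observable
martingale ⟹ driving martingales — being theorems of the tree. PROVED.
[cite: CDHKSCRAS2014, Thm. 1, §§2–3] -/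
theorem convergesInLawToSLE_three_isingInterface_zd_of_traversalBound_of_cylinderIdentity
    (h1 : spinInterface_traversalBound)
    (h : ∀ (D : DobrushinDomain) (E : ℝ → DiscreteDobrushin) (_hE : IsDiscretisation D E)
      (sel : ℝ → SpinConfig (Site 2) → List (Sym2 (Site 2)))
      (_hsel : ∀ δ, IsInterfaceSelection (E δ) (sel δ))
      (u : ℕ → ℝ) (_hu : Tendsto u atTop (𝓝[>] 0))
      (ν : Measure (CurveClass ℂ)) [IsProbabilityMeasure ν],
      (∀ f : CurveClass ℂ →ᵇ ℝ,
        Tendsto (fun n => ∫ c, f c ∂spinInterfaceLaw D E sel (u n)) atTop (𝓝 (∫ c, f c ∂ν))) →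
      ∃ (φ : ConformalEquiv upperHalfPlaneSet D.carrier) (W : CurveClass ℂ → ℝ≥0 → ℝ),
        D.IsChordalUniformizing φ ∧
        (∀ t, StronglyMeasurable (fun c ↦ W c t)) ∧ (∀ c, Continuous (W c)) ∧ (∀ c, W c 0 = 0) ∧
        (∀ t : ℝ≥0, ∃ M : CurveClass ℂ → ℝ, MemLp M 3 ν ∧ (∀ c, 0 ≤ M c) ∧
          ∀ᵐ c ∂ν, ∀ r, r ≤ t → |W c r| ≤ M c) ∧
        (∀ᵐ c ∂ν, RandomPlanarGeometry.IsLoewnerDescribed φ c (W c)) ∧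
        ∀ y : ℝ, 0 < y → ∀ s t : ℝ≥0, s ≤ t → ∀ (n : ℕ) (S : Fin n → ℝ≥0), (∀ k, S k ≤ s) →
          ∀ ψ : (Fin n → ℝ) → ℝ, Continuous ψ → (∀ v, |ψ v| ≤ 1) →
            ∫ c, (spinObservableProcess (fun t c ↦ W c t) y t c -
                spinObservableProcess (fun t c ↦ W c t) y s c) *
              (ψ (fun k ↦ W c (S k)) : ℂ) ∂ν = 0) :
    convergesInLawToSLE_three_isingInterface_zd :=
  convergesInLawToSLE_three_isingInterface_zd_of_traversalBound' h1
    (isSLELaw_three_of_subseqLimit_spinInterface_of_cylinderIdentity h)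

end Literature.Probability.LatticeModels
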